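import Mathlib.Tactic
import HarnessLib
import HarnessLib.Audit.Tags
import Summits.CriticalPhenomena.PercolationContinuityZ3.Theorems.PercNearOneGluingNoHeavyLowerTailSahiAntichainSmallSideFour
import Summits.CriticalPhenomena.PercolationContinuityZ3.Theorems.PercNearOneGluingNoHeavyLowerTailSahiAntichainDaykinRect

/-!
# Antichains, meets plus joins: the mid range `7 ≤ N ≤ 12` from three finite lemmas, and V5 from four

Support file (seat `prim-masterthm-p1`, gen 37; `--supports stmt-CriticalPhenomena-4575`).  No `sorry`, no new definitions, standard
axioms.  Memo `run/shared/lean/prim/prim-masterthm/FROM-prim-masterthm-p1-g37-LINEAR-REDUCTION.md` §3.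

SETTING: `…SahiAntichainLinear` reduced V5 to `AntichainMidRange` (every antichain with `7 ≤ #P ≤ 12` has `2 #P ≤ f P`) and
`AntichainSmallSide`; `…SmallSideFour` reduced the latter to the finite lemmas «L3» (five members ⟹ ten labels) and «L4» (a six-member
side with few labels creates new labels).

NEW HERE ([this work], gen 37).  `antichainMidRange_of`: **`AntichainMidRange` follows from three finite lemmas**, each verified
exhaustively on `2^6` and by annealing on 7–10 points (kit j288399):
* «L3»  every five-member antichain has `f ≥ 10` (kernel: `≥ 9`; data: minimum 10);
* «L4⁺» a six-member side with at most twelve labels of its own creates at least FOUR new labels (data: such a side is a blow-up of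
  `C([4],2)` with exactly ten labels, and then `newLabels ≥ 4`, attained);
* «E3c» a three-member (co)sunflower side (`f ≤ 4`, `three_members_trichotomy`) facing a four-member CO-sunflower side below
  (a single join) creates at least three new labels (data: `≥ 5`); the other orientations of the `3 + 4` (co)sunflower pairs are
  settled here by Daykin's inequality on the cross rectangle (`…SahiAntichainDaykinRect`), and the dual of E3c (a four-member
  SUNFLOWER above three (co)sunflower members) is E3c applied to the complemented family.
The proof is the case table of memo §3: induction on `N` from 7 to 12; at an effective point with sides of `p ≤ q` members (the case
`p > q` is moved to the complemented family), a side with at least seven members is bounded by the induction hypothesis, smaller sides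
by `f(1..6) ≥ 0, 2, 4, 7, 10, 10` and the kernel's one- and two-member and (co)sunflower steps, `…SplitThree` (three members create a label)
and `…FourSeven` (four members with seven labels form a (co)sunflower); the only joint case is `3 + 4` with both sides (co)sunflowers (E3),
and the only places where four new labels are needed are the `C([4],2)`-type six-sides (L4⁺).
Consequently (`two_mul_card_le_of_L3_L4_E3`) **V5 — indeed `f ≥ 2N` for `N ≥ 7` — follows from L3, L4⁺ and E3c alone.**
HONEST FRAMING: L3, L4⁺, E3c and V5 remain OPEN (finite, exhaustively verified statements). [this work]
-/

namespace Summit.CriticalPhenomena.PercolationContinuityZ3.Theorems.SahiColouredDaykin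

open Finset

variable {α : Type*} [DecidableEq α]

/-! ### 1. Local consequences of the kernel classification lemmas -/

/-- A three-member side above with at most four labels is a (co)sunflower, hence creates two new labels. [this work] -/
theorem two_le_newLabels_of_above_three_le_four {P : Finset (Finset α)} {r : α} (hanti : IsAntichain (· ⊆ ·) (P : Set (Finset α)))
    (h3 : #(above P r) = 3) (hB : (below P r).Nonempty) (hf : #(meets (above P r)) + #(joins (above P r)) ≤ 4) :
    2 ≤ newLabels P r := by
  rcases three_members_trichotomy (isAntichain_above hanti r) h3 with ⟨K, hK⟩ | ⟨U, hU⟩ | h5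
  · exact two_le_newLabels_of_above_sunflower hanti (by omega) hB hK
  · exact two_le_newLabels_of_above_cosunflower hanti (by omega) hB hU
  · omega

/-- A three-member side below with at most four labels creates two new labels. [this work] -/
theorem two_le_newLabels_of_below_three_le_four {P : Finset (Finset α)} {r : α} (hanti : IsAntichain (· ⊆ ·) (P : Set (Finset α)))
    (h3 : #(below P r) = 3) (hA : (above P r).Nonempty) (hf : #(meets (below P r)) + #(joins (below P r)) ≤ 4) :
    2 ≤ newLabels P r := by
  rcases three_members_trichotomy (isAntichain_below hanti r) h3 with ⟨K, hK⟩ | ⟨U, hU⟩ | h5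
  · exact two_le_newLabels_of_below_sunflower hanti (by omega) hA hK
  · exact two_le_newLabels_of_below_cosunflower hanti (by omega) hA hU
  · omega

/-- A four-member side above with at most seven labels is a (co)sunflower, hence creates two new labels. [this work] -/
theorem two_le_newLabels_of_above_four_le_seven {P : Finset (Finset α)} {r : α} (hanti : IsAntichain (· ⊆ ·) (P : Set (Finset α)))
    (h4 : #(above P r) = 4) (hB : (below P r).Nonempty) (hf : #(meets (above P r)) + #(joins (above P r)) ≤ 7) :
    2 ≤ newLabels P r := by
  rcases sunflower_or_cosunflower_of_card_eq_four (isAntichain_above hanti r) h4 hf with ⟨K, hK⟩ | ⟨U, hU⟩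
  · exact two_le_newLabels_of_above_sunflower hanti (by omega) hB hK
  · exact two_le_newLabels_of_above_cosunflower hanti (by omega) hB hU

/-- A four-member side below with at most seven labels creates two new labels. [this work] -/
theorem two_le_newLabels_of_below_four_le_seven {P : Finset (Finset α)} {r : α} (hanti : IsAntichain (· ⊆ ·) (P : Set (Finset α)))
    (h4 : #(below P r) = 4) (hA : (above P r).Nonempty) (hf : #(meets (below P r)) + #(joins (below P r)) ≤ 7) :
    2 ≤ newLabels P r := by
  rcases sunflower_or_cosunflower_of_card_eq_four (isAntichain_below hanti r) h4 hf with ⟨K, hK⟩ | ⟨U, hU⟩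
  · exact two_le_newLabels_of_below_sunflower hanti (by omega) hA hK
  · exact two_le_newLabels_of_below_cosunflower hanti (by omega) hA hU

/-! ### 2. The mid range from L3, L4⁺, E3 -/

/-- **`AntichainMidRange` from the three finite lemmas L3, L4⁺, E3** (file header; memo §3). [this work] -/
theorem antichainMidRange_of
    (hL3 : ∀ Q : Finset (Finset α), IsAntichain (· ⊆ ·) (Q : Set (Finset α)) → #Q = 5 → 10 ≤ #(meets Q) + #(joins Q))
    (hL4 : ∀ (P : Finset (Finset α)) (r : α), IsAntichain (· ⊆ ·) (P : Set (Finset α)) → #(above P r) = 6 →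
      (below P r).Nonempty → #(meets (above P r)) + #(joins (above P r)) ≤ 12 → 4 ≤ newLabels P r)
    (hL4' : ∀ (P : Finset (Finset α)) (r : α), IsAntichain (· ⊆ ·) (P : Set (Finset α)) → #(below P r) = 6 →
      (above P r).Nonempty → #(meets (below P r)) + #(joins (below P r)) ≤ 12 → 4 ≤ newLabels P r)
    (hE3c : ∀ (P : Finset (Finset α)) (r : α), IsAntichain (· ⊆ ·) (P : Set (Finset α)) → #(above P r) = 3 → #(below P r) = 4 →
      #(meets (above P r)) + #(joins (above P r)) ≤ 4 → #(joins (below P r)) ≤ 1 → 3 ≤ newLabels P r)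
    (hE3c' : ∀ (P : Finset (Finset α)) (r : α), IsAntichain (· ⊆ ·) (P : Set (Finset α)) → #(below P r) = 3 → #(above P r) = 4 →
      #(meets (below P r)) + #(joins (below P r)) ≤ 4 → #(meets (above P r)) ≤ 1 → 3 ≤ newLabels P r) :
    AntichainMidRange α := by
  suffices H : ∀ n, 7 ≤ n → n ≤ 12 → ∀ P : Finset (Finset α), #P = n → IsAntichain (· ⊆ ·) (P : Set (Finset α)) →
      2 * #P ≤ #(meets P) + #(joins P) from fun P hP h7 h12 => H _ h7 h12 P rfl hP
  intro n
  induction n using Nat.strong_induction_on with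
  | _ n ih =>
    intro h7 h12 P hPn hanti
    obtain ⟨r, hr⟩ := effPoints_nonempty (by omega : 2 ≤ #P)
    obtain ⟨hA, hB⟩ := mem_effPoints_iff.1 hr
    have hcard := card_above_add_card_below P r
    have hApos : 0 < #(above P r) := card_pos.2 hA
    have hBpos : 0 < #(below P r) := card_pos.2 hB
    have hsplit := card_meets_add_card_joins_split P r
    have hantiA := isAntichain_above hanti r
    have hantiB := isAntichain_below hanti r
    -- generic lower bounds for the two sides: V5 for at most eight members, and the induction hypothesis above seven
    have vA : #(above P r) ≤ 8 → 2 * #(above P r) ≤ #(meets (above P r)) + #(joins (above P r)) + 2 :=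
      fun h => two_mul_card_le_of_card_le_eight _ hantiA h
    have vB : #(below P r) ≤ 8 → 2 * #(below P r) ≤ #(meets (below P r)) + #(joins (below P r)) + 2 :=
      fun h => two_mul_card_le_of_card_le_eight _ hantiB h
    have iA : 7 ≤ #(above P r) → 2 * #(above P r) ≤ #(meets (above P r)) + #(joins (above P r)) :=
      fun h => ih _ (by omega) h (by omega) _ rfl hantiA
    have iB : 7 ≤ #(below P r) → 2 * #(below P r) ≤ #(meets (below P r)) + #(joins (below P r)) :=
      fun h => ih _ (by omega) h (by omega) _ rfl hantiB
    -- small-side facts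
    have sA2 : #(above P r) ≤ 2 → 2 ≤ newLabels P r := fun h => two_le_newLabels_of_min_le_two hanti hA hB (Or.inl h)
    have sB2 : #(below P r) ≤ 2 → 2 ≤ newLabels P r := fun h => two_le_newLabels_of_min_le_two hanti hA hB (Or.inr h)
    have uA3 : #(above P r) = 3 → 1 ≤ newLabels P r := fun h => newLabels_pos_of_card_above_eq_three hanti h hB
    have uB3 : #(below P r) = 3 → 1 ≤ newLabels P r := fun h => newLabels_pos_of_card_below_eq_three hanti h hA
    have sA3 : #(above P r) = 3 → #(meets (above P r)) + #(joins (above P r)) ≤ 4 → 2 ≤ newLabels P r :=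
      fun h hf => two_le_newLabels_of_above_three_le_four hanti h hB hf
    have sB3 : #(below P r) = 3 → #(meets (below P r)) + #(joins (below P r)) ≤ 4 → 2 ≤ newLabels P r :=
      fun h hf => two_le_newLabels_of_below_three_le_four hanti h hA hf
    have fA4 : #(above P r) = 4 → 7 ≤ #(meets (above P r)) + #(joins (above P r)) := fun h => seven_le_of_card_eq_four hantiA h
    have fB4 : #(below P r) = 4 → 7 ≤ #(meets (below P r)) + #(joins (below P r)) := fun h => seven_le_of_card_eq_four hantiB h
    have sA4 : #(above P r) = 4 → #(meets (above P r)) + #(joins (above P r)) ≤ 7 → 2 ≤ newLabels P r :=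
      fun h hf => two_le_newLabels_of_above_four_le_seven hanti h hB hf
    have sB4 : #(below P r) = 4 → #(meets (below P r)) + #(joins (below P r)) ≤ 7 → 2 ≤ newLabels P r :=
      fun h hf => two_le_newLabels_of_below_four_le_seven hanti h hA hf
    have fA5 : #(above P r) = 5 → 10 ≤ #(meets (above P r)) + #(joins (above P r)) := fun h => hL3 _ hantiA h
    have fB5 : #(below P r) = 5 → 10 ≤ #(meets (below P r)) + #(joins (below P r)) := fun h => hL3 _ hantiB h
    have sA6 : #(above P r) = 6 → #(meets (above P r)) + #(joins (above P r)) ≤ 12 → 4 ≤ newLabels P r :=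
      fun h hf => hL4 P r hanti h hB hf
    have sB6 : #(below P r) = 6 → #(meets (below P r)) + #(joins (below P r)) ≤ 12 → 4 ≤ newLabels P r :=
      fun h hf => hL4' P r hanti h hA hf
    have e34 : #(above P r) = 3 → #(below P r) = 4 → #(meets (above P r)) + #(joins (above P r)) ≤ 4 →
        #(meets (below P r)) + #(joins (below P r)) ≤ 7 → 3 ≤ newLabels P r := by
      intro h h' hf hf'
      rcases sunflower_or_cosunflower_of_card_eq_four hantiB h' hf' with ⟨K, hK⟩ | ⟨U, hU⟩
      · exact three_le_newLabels_of_three_sunflower_four h h' hK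
      · exact hE3c P r hanti h h' hf (card_joins_le_one_of_cosunflower hU)
    have e43 : #(below P r) = 3 → #(above P r) = 4 → #(meets (below P r)) + #(joins (below P r)) ≤ 4 →
        #(meets (above P r)) + #(joins (above P r)) ≤ 7 → 3 ≤ newLabels P r := by
      intro h h' hf hf'
      rcases sunflower_or_cosunflower_of_card_eq_four hantiA h' hf' with ⟨K, hK⟩ | ⟨U, hU⟩
      · exact hE3c' P r hanti h h' hf (card_meets_le_one_of_sunflower hK)
      · exact three_le_newLabels_of_cosunflower_four_three h' h hU
    -- the case table
    rw [hPn] at hcard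
    by_cases hp1 : #(above P r) ≤ 2
    · have h2 := sA2 hp1
      have := vA (by omega)
      by_cases hq7 : 7 ≤ #(below P r)
      · have := iB hq7; omega
      by_cases hq5 : #(below P r) = 5
      · have := fB5 hq5; omega
      · have hq6 : #(below P r) = 6 := by omega
        have := vB (by omega)
        by_cases hf : #(meets (below P r)) + #(joins (below P r)) ≤ 12
        · have := sB6 hq6 hf; omega
        · omega
    by_cases hq1 : #(below P r) ≤ 2
    · have h2 := sB2 hq1
      have := vB (by omega)
      by_cases hp7 : 7 ≤ #(above P r)
      · have := iA hp7; omega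
      by_cases hp5 : #(above P r) = 5
      · have := fA5 hp5; omega
      · have hp6 : #(above P r) = 6 := by omega
        have := vA (by omega)
        by_cases hf : #(meets (above P r)) + #(joins (above P r)) ≤ 12
        · have := sA6 hp6 hf; omega
        · omega
    by_cases hp3 : #(above P r) = 3
    · have := vA (by omega)
      have h1 := uA3 hp3
      by_cases hq7 : 7 ≤ #(below P r)
      · have := iB hq7
        by_cases hf : #(meets (above P r)) + #(joins (above P r)) ≤ 4
        · have := sA3 hp3 hf; omega
        · omega
      by_cases hq4 : #(below P r) = 4
      · have h7B := fB4 hq4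
        by_cases hf : #(meets (above P r)) + #(joins (above P r)) ≤ 4
        · by_cases hf' : #(meets (below P r)) + #(joins (below P r)) ≤ 7
          · have := e34 hp3 hq4 hf hf'; omega
          · have := sA3 hp3 hf; omega
        · by_cases hf' : #(meets (below P r)) + #(joins (below P r)) ≤ 7
          · have := sB4 hq4 hf'; omega
          · omega
      by_cases hq5 : #(below P r) = 5
      · have := fB5 hq5
        by_cases hf : #(meets (above P r)) + #(joins (above P r)) ≤ 4
        · have := sA3 hp3 hf; omega
        · omega
      · have hq6 : #(below P r) = 6 := by omega
        have := vB (by omega)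
        by_cases hf' : #(meets (below P r)) + #(joins (below P r)) ≤ 12
        · have := sB6 hq6 hf'; omega
        · by_cases hf : #(meets (above P r)) + #(joins (above P r)) ≤ 4
          · have := sA3 hp3 hf; omega
          · omega
    by_cases hq3 : #(below P r) = 3
    · have := vB (by omega)
      have h1 := uB3 hq3
      by_cases hp7 : 7 ≤ #(above P r)
      · have := iA hp7
        by_cases hf : #(meets (below P r)) + #(joins (below P r)) ≤ 4
        · have := sB3 hq3 hf; omega
        · omega
      by_cases hp4 : #(above P r) = 4
      · have h7A := fA4 hp4
        by_cases hf : #(meets (below P r)) + #(joins (below P r)) ≤ 4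
        · by_cases hf' : #(meets (above P r)) + #(joins (above P r)) ≤ 7
          · have := e43 hq3 hp4 hf hf'; omega
          · have := sB3 hq3 hf; omega
        · by_cases hf' : #(meets (above P r)) + #(joins (above P r)) ≤ 7
          · have := sA4 hp4 hf'; omega
          · omega
      by_cases hp5 : #(above P r) = 5
      · have := fA5 hp5
        by_cases hf : #(meets (below P r)) + #(joins (below P r)) ≤ 4
        · have := sB3 hq3 hf; omega
        · omega
      · have hp6 : #(above P r) = 6 := by omega
        have := vA (by omega)
        by_cases hf' : #(meets (above P r)) + #(joins (above P r)) ≤ 12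
        · have := sA6 hp6 hf'; omega
        · by_cases hf : #(meets (below P r)) + #(joins (below P r)) ≤ 4
          · have := sB3 hq3 hf; omega
          · omega
    by_cases hp4 : #(above P r) = 4
    · have h7A := fA4 hp4
      by_cases hq7 : 7 ≤ #(below P r)
      · have := iB hq7
        by_cases hf : #(meets (above P r)) + #(joins (above P r)) ≤ 7
        · have := sA4 hp4 hf; omega
        · omega
      by_cases hq4 : #(below P r) = 4
      · have h7B := fB4 hq4
        by_cases hf : #(meets (above P r)) + #(joins (above P r)) ≤ 7
        · have := sA4 hp4 hf; omega
        · by_cases hf' : #(meets (below P r)) + #(joins (below P r)) ≤ 7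
          · have := sB4 hq4 hf'; omega
          · omega
      by_cases hq5 : #(below P r) = 5
      · have := fB5 hq5
        by_cases hf : #(meets (above P r)) + #(joins (above P r)) ≤ 7
        · have := sA4 hp4 hf; omega
        · omega
      · have hq6 : #(below P r) = 6 := by omega
        have := vB (by omega)
        by_cases hf' : #(meets (below P r)) + #(joins (below P r)) ≤ 12
        · have := sB6 hq6 hf'; omega
        · omega
    by_cases hq4 : #(below P r) = 4
    · have h7B := fB4 hq4
      by_cases hp7 : 7 ≤ #(above P r)
      · have := iA hp7
        by_cases hf : #(meets (below P r)) + #(joins (below P r)) ≤ 7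
        · have := sB4 hq4 hf; omega
        · omega
      by_cases hp5 : #(above P r) = 5
      · have := fA5 hp5
        by_cases hf : #(meets (below P r)) + #(joins (below P r)) ≤ 7
        · have := sB4 hq4 hf; omega
        · omega
      · have hp6 : #(above P r) = 6 := by omega
        have := vA (by omega)
        by_cases hf' : #(meets (above P r)) + #(joins (above P r)) ≤ 12
        · have := sA6 hp6 hf'; omega
        · omega
    -- both sides have five or more members
    by_cases hp5 : #(above P r) = 5
    · have := fA5 hp5
      by_cases hq7 : 7 ≤ #(below P r)
      · have := iB hq7; omega
      by_cases hq5 : #(below P r) = 5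
      · have := fB5 hq5; omega
      · have hq6 : #(below P r) = 6 := by omega
        have := vB (by omega)
        by_cases hf' : #(meets (below P r)) + #(joins (below P r)) ≤ 12
        · have := sB6 hq6 hf'; omega
        · omega
    by_cases hq5 : #(below P r) = 5
    · have := fB5 hq5
      by_cases hp7 : 7 ≤ #(above P r)
      · have := iA hp7; omega
      · have hp6 : #(above P r) = 6 := by omega
        have := vA (by omega)
        by_cases hf' : #(meets (above P r)) + #(joins (above P r)) ≤ 12
        · have := sA6 hp6 hf'; omega
        · omega
    -- six or more on both sides: only `6 + 6` fits below thirteen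
    have hp6 : #(above P r) = 6 := by omega
    have hq6 : #(below P r) = 6 := by omega
    have := vA (by omega)
    have := vB (by omega)
    by_cases hf : #(meets (above P r)) + #(joins (above P r)) ≤ 12
    · have := sA6 hp6 hf; omega
    by_cases hf' : #(meets (below P r)) + #(joins (below P r)) ≤ 12
    · have := sB6 hq6 hf'; omega
    · omega

/-! ### 3. V5 from the four finite lemmas -/

/-- The dual six-side lemma (small side below) follows from the `above` version by complementation. [this work] -/
theorem sixSide_below_of_above
    (hL4 : ∀ (P : Finset (Finset α)) (r : α), IsAntichain (· ⊆ ·) (P : Set (Finset α)) → #(above P r) = 6 →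
      (below P r).Nonempty → #(meets (above P r)) + #(joins (above P r)) ≤ 12 → 4 ≤ newLabels P r) :
    ∀ (P : Finset (Finset α)) (r : α), IsAntichain (· ⊆ ·) (P : Set (Finset α)) → #(below P r) = 6 →
      (above P r).Nonempty → #(meets (below P r)) + #(joins (below P r)) ≤ 12 → 4 ≤ newLabels P r := by
  intro P r hanti h6 hA hf
  set F := insert r (P.sup id) with hF
  have hP : ∀ a ∈ P, a ⊆ F := subset_insert_sup P r
  have hPB : ∀ a ∈ below P r, a ⊆ F := fun a ha => hP a (below_subset P r ha)
  have hr : r ∈ F := mem_insert_self _ _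
  rw [← newLabels_image_compl hP hr]
  refine hL4 (P.image (F \ ·)) r (isAntichain_image_compl hanti hP) (by rw [card_above_image_compl hP hr]; exact h6)
    (by rw [below_image_compl (P := P) hr]; exact hA.image _) ?_
  rw [above_image_compl (P := P) hr, card_meets_add_card_joins_image_compl hPB]
  exact hf

/-- The dual of E3c (a four-member sunflower above, three (co)sunflower members below) follows from E3c by complementation. [this work] -/
theorem threeFour_below_of_above
    (hE3c : ∀ (P : Finset (Finset α)) (r : α), IsAntichain (· ⊆ ·) (P : Set (Finset α)) → #(above P r) = 3 → #(below P r) = 4 →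
      #(meets (above P r)) + #(joins (above P r)) ≤ 4 → #(joins (below P r)) ≤ 1 → 3 ≤ newLabels P r) :
    ∀ (P : Finset (Finset α)) (r : α), IsAntichain (· ⊆ ·) (P : Set (Finset α)) → #(below P r) = 3 → #(above P r) = 4 →
      #(meets (below P r)) + #(joins (below P r)) ≤ 4 → #(meets (above P r)) ≤ 1 → 3 ≤ newLabels P r := by
  intro P r hanti h3 h4 hf3 hm4
  set F := insert r (P.sup id) with hF
  have hP : ∀ a ∈ P, a ⊆ F := subset_insert_sup P r
  have hPA : ∀ a ∈ above P r, a ⊆ F := fun a ha => hP a (above_subset P r ha)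
  have hPB : ∀ a ∈ below P r, a ⊆ F := fun a ha => hP a (below_subset P r ha)
  have hr : r ∈ F := mem_insert_self _ _
  rw [← newLabels_image_compl hP hr]
  refine hE3c (P.image (F \ ·)) r (isAntichain_image_compl hanti hP) (by rw [card_above_image_compl hP hr]; exact h3)
    (by rw [card_below_image_compl hP hr]; exact h4) ?_ ?_
  · rw [above_image_compl (P := P) hr, card_meets_add_card_joins_image_compl hPB]; exact hf3
  · rw [below_image_compl (P := P) hr, card_joins_image_compl hPA]; exact hm4

/-- **V5 from four finite lemmas.**  If «L3» every five-member antichain has ten labels, «L4⁺» every six-member side with at most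
twelve labels creates four new labels, and «E3c» a three-member (co)sunflower side above a four-member co-sunflower side creates three, then every antichain satisfies
`2 #P ≤ #meets P + #joins P + 2` (and `2 #P ≤ #meets P + #joins P` once `#P ≥ 7`). [this work] -/
theorem two_mul_card_le_of_L3_L4_E3
    (hL3 : ∀ Q : Finset (Finset α), IsAntichain (· ⊆ ·) (Q : Set (Finset α)) → #Q = 5 → 10 ≤ #(meets Q) + #(joins Q))
    (hL4 : ∀ (P : Finset (Finset α)) (r : α), IsAntichain (· ⊆ ·) (P : Set (Finset α)) → #(above P r) = 6 →
      (below P r).Nonempty → #(meets (above P r)) + #(joins (above P r)) ≤ 12 → 4 ≤ newLabels P r)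
    (hE3c : ∀ (P : Finset (Finset α)) (r : α), IsAntichain (· ⊆ ·) (P : Set (Finset α)) → #(above P r) = 3 → #(below P r) = 4 →
      #(meets (above P r)) + #(joins (above P r)) ≤ 4 → #(joins (below P r)) ≤ 1 → 3 ≤ newLabels P r) :
    ∀ P : Finset (Finset α), IsAntichain (· ⊆ ·) (P : Set (Finset α)) → 2 * #P ≤ #(meets P) + #(joins P) + 2 := by
  have hM := antichainMidRange_of hL3 hL4 (sixSide_below_of_above hL4) hE3c (threeFour_below_of_above hE3c)
  have hS := antichainSmallSide_of (α := α) hL3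
    (fun P r hanti h6 hB hf => le_trans (by norm_num) (hL4 P r hanti h6 hB (by omega)))
  exact two_mul_card_le_of_linear hM hS

/-- The linear form from the same lemmas: `7 ≤ #P → 2 #P ≤ #meets P + #joins P`. [this work] -/
theorem two_mul_card_le_linear_of_L3_L4_E3
    (hL3 : ∀ Q : Finset (Finset α), IsAntichain (· ⊆ ·) (Q : Set (Finset α)) → #Q = 5 → 10 ≤ #(meets Q) + #(joins Q))
    (hL4 : ∀ (P : Finset (Finset α)) (r : α), IsAntichain (· ⊆ ·) (P : Set (Finset α)) → #(above P r) = 6 →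
      (below P r).Nonempty → #(meets (above P r)) + #(joins (above P r)) ≤ 12 → 4 ≤ newLabels P r)
    (hE3c : ∀ (P : Finset (Finset α)) (r : α), IsAntichain (· ⊆ ·) (P : Set (Finset α)) → #(above P r) = 3 → #(below P r) = 4 →
      #(meets (above P r)) + #(joins (above P r)) ≤ 4 → #(joins (below P r)) ≤ 1 → 3 ≤ newLabels P r) :
    ∀ P : Finset (Finset α), IsAntichain (· ⊆ ·) (P : Set (Finset α)) → 7 ≤ #P → 2 * #P ≤ #(meets P) + #(joins P) := by
  have hM := antichainMidRange_of hL3 hL4 (sixSide_below_of_above hL4) hE3c (threeFour_below_of_above hE3c)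
  have hS := antichainSmallSide_of (α := α) hL3
    (fun P r hanti h6 hB hf => le_trans (by norm_num) (hL4 P r hanti h6 hB (by omega)))
  exact two_mul_card_le_linear hM hS

end Summit.CriticalPhenomena.PercolationContinuityZ3.Theorems.SahiColouredDaykin
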